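import Summits.QuantumFields.BalabanUV.T4Continuum.Support.NE7K1LinBoxResolventImagesDeriv
import Summits.QuantumFields.BalabanUV.T4Continuum.Support.NE7K1LinBoxCov237

/-!
# NE7K1LinBoxLemma24 — row NE7 (node U5), candidate route HOM, path H1L, cell K1-lin(s): NEEDS-ESTIMATE #E1 —
# B4 LEMMA 2.4 (2.35)–(2.36)–(2.37) AND PROP. 2.3 (1.15) FOR THE TWO-CUTOFF LINE ON A NEUMANN BOX, IN THE PRINTED QUANTIFIER SHAPE:
# «there exist positive constants c₀, δ₀, and for α<1 a constant c₁, such that … for arbitrary j [mesh], arbitrary rectangular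
# parallelepiped □ built of large blocks» — AND FOR EVERY `s ∈ [0,1]` AND EVERY REFINEMENT `L ≥ 1` OF THE LINE

Lineage `b2b-balaban-t4-ne7-p2` (CRUX PROVER NE7 #2), generation 77; file 82 — the ASSEMBLY DISPLAY of files 77–81 for the card's
multi-step bookkeeping (PRICING-NE7 v39 §285 (g): «#E1 CLOSES … when (o2) and (o3) are ✓ by tree sha»).  Everything is stated on b04's
index types (`↥(boxDom (n·M))` fine box, `↥(boxDom M)` unit box) with file 80's transported line `boxLine L hn M a s = T^Π(s) + aQ_n^*Q_n`
and its inverse `G^Π(s)`; the constants are closed terms in `(d, a₋, a₊[, α])` resp. `(d, ℓ, a₋, a₊, a₂₋, a₂₊)`, pulled in front of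
ALL of `n, L, s, a, M, x, y` exactly as printed:

* **`lemma24_line_235_first`** — `|(G^Π(s)Q_n^*)(x, y)| = |Σ_{x′ ∈ B(y)} G^Π(s)(x, x′)| ≤ c₀·e^{−δ₀|blk_n x − y|_∞}` (file 81's
  `boxLine_blockRow_bound`, from file 77);
* **`lemma24_line_235_second`** — `|(∂^{1∕n}_μ G^Π(s)Q_n^*)(x, y)| = |n·Σ_{x′ ∈ B(y)} (G^Π(s)(x+e_μ, x′) − G^Π(s)(x, x′))| ≤ c₀·e^{−δ₀|blk_n x − y|_∞}`
  for `x, x + e_μ ∈ □` (file 79's `boxResolventKernel_step_decay`, transported);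
* **`lemma24_line_236`** — for `0 ≤ α < 1`: `(n∕|sv|_∞)^α·|(∂_μ G^ΠQ^*)(x + sv∕n, y) − (∂_μ G^ΠQ^*)(x, y)| ≤ c₁·e^{−δ₀|blk_n x − y|_∞}` for the
  four points `x, x+e_μ, x+sv, x+sv+e_μ ∈ □`, `sv ≠ 0`, `|sv_ν| ≤ n` (file 79's `boxResolventKernel_holder_decay`, transported);
* (2.37) `|C_s^{(j)}(□; y, y′)| ≤ c·e^{−δ|y−y′|_∞}` and (1.15) are ALREADY in the printed shape in file 81 (`NE7K1LinBoxCov237.cov237S_box_decay`,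
  `cov237S_box_form_bounds`) — cited BY NAME, not restated (the gate's dedup).

HONEST FRAMING: [folklore] re-packaging (real∕complex casts, the reindexing `boxEquiv`, quantifier order); no new estimate; nothing of
Bałaban's asserted; no `sorry`.  A = 0; Neumann BOXES only (the printed geometry of Lemma 2.4); general `Ω`, `Λ` of Prop. 2.3 and the torus
variant are NOT claimed.  Census only (#E1's (o2)(o3) on boxes, assembled); NE7 NOT PRINTED ∕ NOT PROVED; spine 0∕9; FIXED FINITE T⁴, rung
(B)+1; NOT infinite volume, NOT mass gap, NOT Clay.  HONEST DEPENDENCY: continuum YM on T⁴ ⇐ BetaPertH ∧ nine spine estimates (0/9 proved);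
BetaPertH ⇐ (D1) ∧ (D4) ∧ CAP+tail; G-an2-4 gates asym, D1 and NE2/3/4.
-/

noncomputable section

open Finset Matrix

namespace Summit.QuantumFields.BalabanUV.T4Continuum.NE7K1LinBoxLemma24

open Literature.MathematicalPhysics.QuantumFieldTheory.Balaban1983to89
open Literature.MathematicalPhysics.QuantumFieldTheory.Balaban1983to89.B4Reflection242
open Literature.MathematicalPhysics.QuantumFieldTheory.Balaban1983to89.B4Lower18
open Literature.MathematicalPhysics.QuantumFieldTheory.Balaban1983to89.B4ContourShift (supNorm)
open Literature.MathematicalPhysics.QuantumFieldTheory.Balaban1983to89.B4BoxCov237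
open Literature.MathematicalPhysics.QuantumFieldTheory.Balaban1983to89.B4TorusKernel (periodConst)
open Literature.MathematicalPhysics.QuantumFieldTheory.Balaban1983to89.B4Green244 (finePt coarse offset coarse_finePt
  finePt_coarse_offset e)
open NE7K1LinSchurLineU1 NE7K1LinSchurFoldBox NE7K1LinStripClassLine NE7K1LinStripClassLineDecay NE7K1LinStripClassLineHolder
open NE7K1LinBoxResolventImages NE7K1LinBoxResolventImagesDeriv NE7K1LinBoxCovEnergy NE7K1LinBoxCov237

variable {d : ℕ}

/-! ### §1 Transport of file 79's box statements to b04's index type, real form -/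

section Transport

variable {n : ℕ} (L : ℕ) [NeZero L] {M : Fin (d + 1) → ℕ}

/-- the complex block-row sum of file 77∕79 at the label `(boxEquiv)⁻¹ x` is the cast of the real block-row sum of `G^Π(s) = boxLine⁻¹` at `x`.
[folklore] -/
theorem blockRow_cast (hn : 1 ≤ n) (a s : ℝ) (x : ↥(boxDom fun i => n * M i)) (y : Fin (d + 1) → ℤ) :
    (∑ z' : ↥((boxDom fun i => n * L * M i).image (blk L)),
      (((twoCutoffLine (isBlockUnion_fine (fineBox_isBlockUnion hn (NeZero.one_le : 1 ≤ L) M)) n a s)⁻¹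
          ((boxEquiv n L M).symm x) z' : ℝ) : ℂ) * (if blk n z'.1 = y then (1 : ℂ) else 0)) =
      ((∑ x' ∈ Finset.univ.filter (fun x' : ↥(boxDom fun i => n * M i) => blk n x'.1 = y), (boxLine L hn M a s)⁻¹ x x' : ℝ) : ℂ) := by
  rw [Finset.sum_filter, ← Equiv.sum_comp (boxEquiv n L M).symm]
  push_cast
  refine Finset.sum_congr rfl fun x' _ => ?_
  rw [boxLine_inv_apply]
  have hx' : ((boxEquiv n L M).symm x').1 = x'.1 := rfl
  rw [hx']
  split_ifs <;> simp

end Transport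

/-! ### §2 Lemma 2.4 and Prop. 2.3 (1.15) for the line on boxes, printed quantifier shape -/

section Printed

/-- **(2.35), FIRST QUANTITY, FOR THE LINE** — «`|(G_j(□)Q_j^*)(x, y)| ≤ c₀e^{−δ₀|x−y|}`»: there are `δ₀, c₀ > 0` depending on `(d, a₋, a₊)`
ONLY such that for every mesh `n ≥ 1`, refinement `L ≥ 1`, `a ∈ [a₋,a₊]`, `s ∈ [0,1]`, box `M` and all `x ∈ □`, `y ∈ □^{(j)}`:
`|Σ_{x′ : blk_n x′ = y} G^Π(s)(x, x′)| ≤ c₀·e^{−δ₀|blk_n x − y|_∞}`. [folklore] -/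
theorem lemma24_line_235_first (d : ℕ) (aminus aplus : ℝ) (ha : 0 < aminus) :
    ∃ δ₀ c₀ : ℝ, 0 < δ₀ ∧ 0 < c₀ ∧ ∀ (n : ℕ) (hn : 1 ≤ n) (L : ℕ) (_ : NeZero L) (a s : ℝ), aminus ≤ a → a ≤ aplus → 0 ≤ s → s ≤ 1 →
      ∀ (M : Fin (d + 1) → ℕ), (∀ i, 1 ≤ M i) → ∀ (x : ↥(boxDom fun i => n * M i)) (y : ↥(boxDom M)),
        |∑ x' ∈ Finset.univ.filter (fun x' : ↥(boxDom fun i => n * M i) => blk n x'.1 = y.1), (boxLine L hn M a s)⁻¹ x x'|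
          ≤ c₀ * Real.exp (-(δ₀ * supNorm (blk n x.1 - y.1))) := by
  refine ⟨kappaLine (d + 1) aminus aplus / (d + 1), Cbox d aminus aplus + 1, div_pos (kappaLine_pos (d + 1) aplus ha) (by positivity),
    by linarith [Cbox_nonneg d aminus aplus], ?_⟩
  intro n hn L _ a s h1 h2 hs0 hs1 M hM x y
  exact (boxLine_blockRow_bound L hn hM ha h1 h2 hs0 hs1 x y).trans
    (mul_le_mul_of_nonneg_right (by linarith) (Real.exp_pos _).le)

/-- **(2.35), SECOND QUANTITY, FOR THE LINE** — «`|(∂_μ^{L^{−j}} G_j(□)Q_j^*)(x, y)| ≤ c₀e^{−δ₀|x−y|}`»: there are `δ₀, c₀ > 0` depending on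
`(d, a₋, a₊)` ONLY such that for every `n ≥ 1`, `L ≥ 1`, `a ∈ [a₋,a₊]`, `s ∈ [0,1]`, box `M`, direction `μ` and all `x, x + e_μ ∈ □`, `y ∈ □^{(j)}`:
`|n·Σ_{x′ : blk_n x′ = y} (G^Π(s)(x+e_μ, x′) − G^Π(s)(x, x′))| ≤ c₀·e^{−δ₀|blk_n x − y|_∞}`. [folklore] -/
theorem lemma24_line_235_second (d : ℕ) (aminus aplus : ℝ) (ha : 0 < aminus) :
    ∃ δ₀ c₀ : ℝ, 0 < δ₀ ∧ 0 < c₀ ∧ ∀ (n : ℕ) (hn : 1 ≤ n) (L : ℕ) (_ : NeZero L) (a s : ℝ), aminus ≤ a → a ≤ aplus → 0 ≤ s → s ≤ 1 →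
      ∀ (M : Fin (d + 1) → ℕ), (∀ i, 1 ≤ M i) → ∀ (μ : Fin (d + 1)) (x x₁ : ↥(boxDom fun i => n * M i)), x₁.1 = x.1 + e μ →
        ∀ (y : ↥(boxDom M)),
        |(n : ℝ) * (∑ x' ∈ Finset.univ.filter (fun x' : ↥(boxDom fun i => n * M i) => blk n x'.1 = y.1), (boxLine L hn M a s)⁻¹ x₁ x'
            - ∑ x' ∈ Finset.univ.filter (fun x' : ↥(boxDom fun i => n * M i) => blk n x'.1 = y.1), (boxLine L hn M a s)⁻¹ x x')|
          ≤ c₀ * Real.exp (-(δ₀ * supNorm (blk n x.1 - y.1))) := by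
  set C : ℝ := max (2 ^ (d + 1) * (MDline d aminus * periodConst (kappaLine (d + 1) aminus aplus) d)) 0 + 1 with hC
  refine ⟨kappaLine (d + 1) aminus aplus / (d + 1), C, div_pos (kappaLine_pos (d + 1) aplus ha) (by positivity),
    by have := le_max_right (2 ^ (d + 1) * (MDline d aminus * periodConst (kappaLine (d + 1) aminus aplus) d)) 0; linarith, ?_⟩
  intro n hn L _ a s h1 h2 hs0 hs1 M hM μ x x₁ hx₁ y
  haveI : NeZero n := ⟨by omega⟩
  set e' := boxEquiv n L M with he'
  have hy0 : (e'.symm x).1 = finePt n (coarse n x.1) (offset n x.1) := (finePt_coarse_offset n x.1).symm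
  have hy1 : (e'.symm x₁).1 = (e'.symm x).1 + e μ := hx₁
  have hb := boxResolventKernel_step_decay hn hM ha h1 h2 hs0 hs1 (e'.symm x) (e'.symm x₁) hy0 μ hy1 y.2
  rw [he', blockRow_cast L hn a s x y.1, blockRow_cast L hn a s x₁ y.1, ← Complex.ofReal_sub, ← Complex.ofReal_natCast,
    ← Complex.ofReal_mul, Complex.norm_real, Real.norm_eq_abs] at hb
  have hco : coarse n x.1 = blk n x.1 := rfl
  rw [hco] at hb
  refine hb.trans (mul_le_mul_of_nonneg_right ?_ (Real.exp_pos _).le)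
  have := le_max_left (2 ^ (d + 1) * (MDline d aminus * periodConst (kappaLine (d + 1) aminus aplus) d)) 0
  linarith

/-- **(2.36) FOR THE LINE** — «`(1∕|x−x′|^α)|(∂_μ G_j(□)Q_j^*)(x, y) − (∂_μ G_j(□)Q_j^*)(x′, y)| ≤ c₁e^{−δ₀ dist({x,x′},y)}`»: for `0 ≤ α < 1` there are
`δ₀, c₁ > 0` depending on `(d, α, a₋, a₊)` ONLY such that for every `n ≥ 1`, `L ≥ 1`, `a ∈ [a₋,a₊]`, `s ∈ [0,1]`, box `M`, direction `μ`, fine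
displacement `sv ≠ 0` with `|sv_ν| ≤ n` (`x′ = x + sv∕n`, `|x − x′| ≤ 1`), box points `x, x+e_μ, x+sv, x+sv+e_μ ∈ □` and `y ∈ □^{(j)}`:
`(n∕|sv|_∞)^α·|n·[(S(x+sv+e_μ) − S(x+sv)) − (S(x+e_μ) − S(x))]| ≤ c₁·e^{−δ₀|blk_n x − y|_∞}`, `S(w) = Σ_{x′ : blk_n x′ = y} G^Π(s)(w, x′)`. [folklore] -/
theorem lemma24_line_236 (d : ℕ) (aminus aplus : ℝ) (ha : 0 < aminus) {α : ℝ} (hα0 : 0 ≤ α) (hα1 : α < 1) :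
    ∃ δ₀ c₁ : ℝ, 0 < δ₀ ∧ 0 < c₁ ∧ ∀ (n : ℕ) (hn : 1 ≤ n) (L : ℕ) (_ : NeZero L) (a s : ℝ), aminus ≤ a → a ≤ aplus → 0 ≤ s → s ≤ 1 →
      ∀ (M : Fin (d + 1) → ℕ), (∀ i, 1 ≤ M i) → ∀ (μ : Fin (d + 1)) (sv : Fin (d + 1) → ℤ), sv ≠ 0 → (∀ ν, |sv ν| ≤ n) →
        ∀ (x x₁ x₂ x₃ : ↥(boxDom fun i => n * M i)), x₁.1 = x.1 + e μ → x₂.1 = x.1 + sv → x₃.1 = x.1 + sv + e μ →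
        ∀ (y : ↥(boxDom M)),
        ((n : ℝ) / supNorm sv) ^ α * |(n : ℝ) *
            ((∑ x' ∈ Finset.univ.filter (fun x' : ↥(boxDom fun i => n * M i) => blk n x'.1 = y.1), (boxLine L hn M a s)⁻¹ x₃ x'
              - ∑ x' ∈ Finset.univ.filter (fun x' : ↥(boxDom fun i => n * M i) => blk n x'.1 = y.1), (boxLine L hn M a s)⁻¹ x₂ x')
            - (∑ x' ∈ Finset.univ.filter (fun x' : ↥(boxDom fun i => n * M i) => blk n x'.1 = y.1), (boxLine L hn M a s)⁻¹ x₁ x'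
              - ∑ x' ∈ Finset.univ.filter (fun x' : ↥(boxDom fun i => n * M i) => blk n x'.1 = y.1), (boxLine L hn M a s)⁻¹ x x'))|
          ≤ c₁ * Real.exp (-(δ₀ * supNorm (blk n x.1 - y.1))) := by
  set C : ℝ := max (2 ^ (d + 1) * (MHline d α aminus * periodConst (kappaLine (d + 1) aminus aplus) d)) 0 + 1 with hC
  refine ⟨kappaLine (d + 1) aminus aplus / (d + 1), C, div_pos (kappaLine_pos (d + 1) aplus ha) (by positivity),
    by have := le_max_right (2 ^ (d + 1) * (MHline d α aminus * periodConst (kappaLine (d + 1) aminus aplus) d)) 0; linarith, ?_⟩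
  intro n hn L _ a s h1 h2 hs0 hs1 M hM μ sv hsv0 hsvn x x₁ x₂ x₃ hx₁ hx₂ hx₃ y
  haveI : NeZero n := ⟨by omega⟩
  set e' := boxEquiv n L M with he'
  have hy0 : (e'.symm x).1 = finePt n (coarse n x.1) (offset n x.1) := (finePt_coarse_offset n x.1).symm
  have hy1 : (e'.symm x₁).1 = (e'.symm x).1 + e μ := hx₁
  have hy2 : (e'.symm x₂).1 = (e'.symm x).1 + sv := hx₂
  have hy3 : (e'.symm x₃).1 = (e'.symm x).1 + sv + e μ := hx₃
  have hb := boxResolventKernel_holder_decay hn hM ha h1 h2 hs0 hs1 hα0 hα1 (e'.symm x) (e'.symm x₁) (e'.symm x₂) (e'.symm x₃)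
    hy0 μ hsv0 hsvn hy1 hy2 hy3 y.2
  rw [he', blockRow_cast L hn a s x y.1, blockRow_cast L hn a s x₁ y.1, blockRow_cast L hn a s x₂ y.1, blockRow_cast L hn a s x₃ y.1,
    ← Complex.ofReal_sub, ← Complex.ofReal_sub, ← Complex.ofReal_sub, ← Complex.ofReal_natCast, ← Complex.ofReal_mul,
    ← Complex.ofReal_mul, Complex.norm_real, Real.norm_eq_abs, abs_mul,
    abs_of_nonneg (Real.rpow_nonneg (div_nonneg (Nat.cast_nonneg n) (B4ContourShift.supNorm_nonneg sv)) α)] at hb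
  have hco : coarse n x.1 = blk n x.1 := rfl
  rw [hco] at hb
  refine hb.trans (mul_le_mul_of_nonneg_right ?_ (Real.exp_pos _).le)
  have := le_max_left (2 ^ (d + 1) * (MHline d α aminus * periodConst (kappaLine (d + 1) aminus aplus) d)) 0
  linarith

end Printed

end Summit.QuantumFields.BalabanUV.T4Continuum.NE7K1LinBoxLemma24

end
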